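import Summits.HodgeConjecture.HodgeConjecture.Theorems.SixfoldTableXCensusQuarticOneScalarAllMembers
import Summits.HodgeConjecture.HodgeConjecture.Theorems.SixfoldTableXCensusQuarticTwoMixedAllMembers
import HarnessLib

/-!
# TABLE X (dimension 6) — row 10 `g6.IV(2,1)` (`End⁰ = E` a QUARTIC CM field, `dim_E H¹ = 3`), ALL MEMBERS WITH A MIXED
# PLACE, NOT OF WEIL TYPE: one kernel verdict for the row, dispatching the CM patterns `(3,0)+(2,1)` (unconditional) and
# `(2,1)+(2,1)` / `(2,1)+(1,2)` (under the displayed geometric `hnW`) — cell `pub-hodgeav-hg6`, req-37 (A) Q2b, eng-5 g7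

HONEST FRAMING. HC, `HC_AV` (stmt-1333), `HC_CM` (stmt-3052) and the rung H2 are NOT proved and do not occur here. The
census nodes X2 / X1 of `SixfoldTableXCover` are OURS (`@[conjecture]`), never asserted; here they are DISCHARGED on one
isogeny class per hypothesis set. KERNEL ONLY: two dispatching theorems over the two pattern modules
`SixfoldTableXCensusQuarticOneScalarAllMembers` (pattern `(3,0)+(2,1)`: one `Θ`-scalar place — `hnW` is not even needed
there) and `SixfoldTableXCensusQuarticTwoMixedAllMembers` (both places mixed, under `hnW`); no definition, no `sorry`, no
named fact; nothing restated. The member data are: `B` simple, `dim B = 6`, `dim_ℚ End⁰(B) = 4`, `φ ∈ End(B)` with colours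
`μ : Fin 2 → ℂ` (injective, none conjugate to another or itself) of pair multiplicity `3`, ONE MIXED PLACE `k₁` (both
multiplicities non-zero — the all-`Θ`-scalar signatures `(3,0)+(3,0)` / `(3,0)+(0,3)` would make `B` of CM type, outside
`End⁰(B) = E`; this exclusion is displayed as member data, not proved here), and the geometric no-Weil-type datum `hnW`
(«`eigenMultiplicity B β (i√d) ≠ eigenMultiplicity B β (−i√d)` for every `β ∈ End(B)` with `β ≫ β = −d`, `d > 0`»; the
Weil-type members are TABLE X row 11, where `Hg ⊆ SU_k ⊊ U_E`).
* `census_row10_quartic_of_mixedPlace` — domain membership ∧ X2-at-`A` ∧ X1-at-`A` at every `A ∼ B`.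
* `hodgeConjectureFor_of_isIsogenous_row10_quartic_of_mixedPlace` — L6's CONCLUSION `HodgeConjectureFor` on the whole
  isogeny class.
HC / HC_AV are NOT proved beyond these statements' own content; typed ≠ proved.
-/

set_option linter.dupNamespace false

noncomputable section

open scoped TensorProduct
open CategoryTheory
open Literature.AlgebraicGeometry Literature.AlgebraicGeometry.Motives
open Literature.AlgebraicGeometry.Motives.AbelianVariety (IsIsogenous IsSimple)
open Literature.AlgebraicGeometry.HodgeTheory
open Literature.AlgebraicGeometry.Milne1999
open Literature.AlgebraicTopology.SingularHomology
open Literature.Barriers.HodgeConjecture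
open Summit.HodgeConjecture.HodgeConjecture.Ring2.ClassTargets
open Summit.HodgeConjecture.HodgeConjecture.Ring2.Motiv (ProdCMCell)
open Summit.HodgeConjecture.HodgeConjecture.Ring2.Atlas (IsQuarticFieldTypeIVFourfold)
open Summit.HodgeConjecture.HodgeConjecture.TableX.SimpleRows

namespace Summit.HodgeConjecture.HodgeConjecture.TableX.TypeIVRows

/-- In `Fin 2`, every index other than `k + 1` is `k`. [folklore] -/
private theorem fin2_eq_of_ne_add_one (k₁ k : Fin 2) (hk : k ≠ k₁ + 1) : k = k₁ := by
  fin_cases k₁ <;> fin_cases k <;> simp_all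

/-- In `Fin 2`, `k + 1 ≠ k`. [folklore] -/
private theorem fin2_add_one_ne (k₁ : Fin 2) : k₁ + 1 ≠ k₁ := by
  fin_cases k₁ <;> decide

/-- **TABLE X ROW 10 `g6.IV(2,1)`, ALL MEMBERS WITH A MIXED PLACE, NOT OF WEIL TYPE — KERNEL VERDICT on the whole isogeny
class** (dispatch: if the other place is `Θ`-scalar, `census_row10_quartic_threeScalarMixed` — unconditional; otherwise both
places are mixed and `census_row10_quartic_threeTwoMixed` applies under the displayed `hnW`). HC ∕ HC_AV NOT proved; X2 ∕ X1
stay `@[conjecture]` globally. [cite: MoonenZarhin1999LowDim, §1 (1.8), §2 (2.3) and §5 (5.1)] [cite: Ribet1983, Thm. 0]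
[cite: vanGeemen1994HodgeAV, Lemma 3.7] [cite: MumfordAV1970, §19 Cor. 2 of Thm. 1 (p. 174)] -/
theorem census_row10_quartic_of_mixedPlace {A B : AbelianVariety ℂ} (hB : B.dim = 6) (hBs : B.IsSimple) (φ : B ⟶ B)
    (hE4 : Module.finrank ℚ B.endAlgebra = 4) (μ : Fin 2 → ℂ) (hinj : Function.Injective μ)
    (hdist : ∀ k k', μ k' ≠ starRingEnd ℂ (μ k))
    (hmult : ∀ k, eigenMultiplicity B φ (μ k) + eigenMultiplicity B φ (starRingEnd ℂ (μ k)) = 3) (k₁ : Fin 2)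
    (hk₁ : eigenMultiplicity B φ (μ k₁) ≠ 0 ∧ eigenMultiplicity B φ (starRingEnd ℂ (μ k₁)) ≠ 0)
    (hnW : ∀ (d : ℕ) (β : B ⟶ B), 0 < d → β ≫ β = -(d • 𝟙 B) →
      eigenMultiplicity B β (Complex.I * (Real.sqrt d : ℂ)) ≠ eigenMultiplicity B β (-(Complex.I * (Real.sqrt d : ℂ))))
    (hAB : IsIsogenous A B) :
    (A.dim = 6 ∧ ¬ (IsOfCMType A ∨ ProdCMCell IsQuarticFieldTypeIVFourfold (fun Z ↦ Z.dim = 2) A)) ∧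
    (∀ c : complexBetti A.X (2 * 2), IsRationalClass c → IsOfHodgeType A.dim A.X (2 * 2) 2 2 c →
      c ∈ divisorClassesSpan A.X A.dim 2 ⊔ Submodule.span ℂ {w' : complexBetti A.X (2 * 2) |
        ∃ (C : AbelianVariety ℂ) (g : A.X ⟶ C.X) (w : complexBetti C.X (2 * 2)), C.dim < A.dim ∧
          IsRationalClass w ∧ IsOfHodgeType C.dim C.X (2 * 2) 2 2 w ∧ w' = complexBetti.map g (2 * 2) w}) ∧
    (∀ c : complexBetti A.X (2 * 3), IsRationalClass c → IsOfHodgeType A.dim A.X (2 * 3) 3 3 c →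
      c ∈ divisorClassesSpan A.X A.dim 3 ⊔ Submodule.span ℂ {w' : complexBetti A.X (2 * 3) |
          ∃ (a : complexBetti A.X (2 * 2)) (b : complexBetti A.X (2 * 1)),
            IsRationalClass a ∧ IsOfHodgeType A.dim A.X (2 * 2) 2 2 a ∧ IsRationalClass b ∧
            IsOfHodgeType A.dim A.X (2 * 1) 1 1 b ∧ w' = cupProduct (two_mul_add_two_mul 2 1) a b} ⊔
        Submodule.span ℂ {w' : complexBetti A.X (2 * 3) |
          ∃ (C : AbelianVariety ℂ) (g : A.X ⟶ C.X) (w : complexBetti C.X (2 * 3)), C.dim < A.dim ∧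
            IsRationalClass w ∧ IsOfHodgeType C.dim C.X (2 * 3) 3 3 w ∧ w' = complexBetti.map g (2 * 3) w} ⊔
        Submodule.span ℂ {w' : complexBetti A.X (2 * 3) |
          ∃ (B' : AbelianVariety ℂ) (g : A.X ⟶ B'.X) (d : ℕ) (ψ : B' ⟶ B') (w : complexBetti B'.X (2 * 3)),
            B'.dim = 6 ∧ 0 < d ∧ ψ ≫ ψ = -(d • 𝟙 B') ∧ IsRationalClass w ∧
            IsOfHodgeType B'.dim B'.X (2 * 3) 3 3 w ∧ w ∈ weilClassesOf B' ψ 3 d ∧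
            w' = complexBetti.map g (2 * 3) w}) := by
  by_cases h : eigenMultiplicity B φ (μ (k₁ + 1)) = 0 ∨ eigenMultiplicity B φ (starRingEnd ℂ (μ (k₁ + 1))) = 0
  · exact census_row10_quartic_threeScalarMixed hB hBs φ hE4 μ hinj hdist hmult (k₁ + 1) h
      (fun k hk => by rw [fin2_eq_of_ne_add_one k₁ k hk]; exact hk₁) hAB
  · rw [not_or] at h
    exact census_row10_quartic_threeTwoMixed hB hBs φ hE4 μ hinj hdist hmult
      (fun k => by
        by_cases hk : k = k₁ + 1
        · rw [hk]; exact h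
        · rw [fin2_eq_of_ne_add_one k₁ k hk]; exact hk₁) hnW hAB

/-- **L6's CONCLUSION on the isogeny class: the Hodge conjecture holds for every complex abelian variety isogenous to a SIMPLE
sixfold `B` with `dim_ℚ End⁰(B) = 4`, `φ ∈ End(B)` of pair multiplicity `3` (so `End⁰(B)` is a quartic CM field with
`dim_E H¹ = 3`), a mixed place, and `B` not of Weil type relative to any `β ∈ End(B)` with `β ≫ β = −d`** — dispatching
`hodgeConjectureFor_of_isIsogenous_cmField_threeScalarMixed` (the other place `Θ`-scalar; `hnW` unused) and
`hodgeConjectureFor_of_isIsogenous_cmField_threeTwoMixed` (both places mixed; `hnW` displayed). None of Markman₄ / Markman₆ /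
R-W6 / X2 / X1 / `HC_CM` enters. HC ∕ HC_AV NOT proved beyond this statement's own content.
[cite: MoonenZarhin1999LowDim, §1 (1.7)–(1.8) and §2 (2.3)] [cite: Ribet1983, Thm. 0] [cite: vanGeemen1994HodgeAV, §2.4 and Lemma 3.7] -/
theorem hodgeConjectureFor_of_isIsogenous_row10_quartic_of_mixedPlace {A B : AbelianVariety ℂ} (hB : B.dim = 6)
    (hBs : B.IsSimple) (φ : B ⟶ B) (hE4 : Module.finrank ℚ B.endAlgebra = 4) (μ : Fin 2 → ℂ)
    (hinj : Function.Injective μ) (hdist : ∀ k k', μ k' ≠ starRingEnd ℂ (μ k))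
    (hmult : ∀ k, eigenMultiplicity B φ (μ k) + eigenMultiplicity B φ (starRingEnd ℂ (μ k)) = 3) (k₁ : Fin 2)
    (hk₁ : eigenMultiplicity B φ (μ k₁) ≠ 0 ∧ eigenMultiplicity B φ (starRingEnd ℂ (μ k₁)) ≠ 0)
    (hnW : ∀ (d : ℕ) (β : B ⟶ B), 0 < d → β ≫ β = -(d • 𝟙 B) →
      eigenMultiplicity B β (Complex.I * (Real.sqrt d : ℂ)) ≠ eigenMultiplicity B β (-(Complex.I * (Real.sqrt d : ℂ))))
    (hAB : IsIsogenous A B) : HodgeConjectureFor A.dim A.X := by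
  have hι : Fintype.card (Fin 2) ≤ 2 := by rw [Fintype.card_fin]
  have hE : Module.finrank ℚ B.endAlgebra = 2 * Fintype.card (Fin 2) := by rw [hE4, Fintype.card_fin]
  have hdim : B.dim = Fintype.card (Fin 2) * 3 := by rw [hB, Fintype.card_fin]
  by_cases h : eigenMultiplicity B φ (μ (k₁ + 1)) = 0 ∨ eigenMultiplicity B φ (starRingEnd ℂ (μ (k₁ + 1))) = 0
  · exact hodgeConjectureFor_of_isIsogenous_cmField_threeScalarMixed hι hBs φ hE μ hinj hdist hmult hdim (k₁ + 1) h
      (fun k hk => by rw [fin2_eq_of_ne_add_one k₁ k hk]; exact hk₁) k₁ (fin2_add_one_ne k₁).symm hAB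
  · rw [not_or] at h
    exact hodgeConjectureFor_of_isIsogenous_cmField_threeTwoMixed hι hBs φ hE μ hinj hdist hmult hdim
      (fun k => by
        by_cases hk : k = k₁ + 1
        · rw [hk]; exact h
        · rw [fin2_eq_of_ne_add_one k₁ k hk]; exact hk₁) k₁ (k₁ + 1) (fin2_add_one_ne k₁).symm hnW hAB

end Summit.HodgeConjecture.HodgeConjecture.TableX.TypeIVRows

end
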